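import Mathlib
import HarnessLib

/-!
# Stub `stub_saintVenant` of line `Sketch` (crux `DyadicWallCascade.ViscousContinuation`,
# stmt-AnomalousDissipation-17917)

Sorry-free discharge of the registered stub `stub_saintVenant` of line `Sketch` of crux
stmt-AnomalousDissipation-17917 (`ViscousContinuation`, thesis `DyadicWallCascade`), card
saint-venant-cap-impedance.

**Statement.** The abstract one-variable core of the Ladyzhenskaya–Solonnikov "Saint-Venant
principle" energy estimate for a layer: an energy profile `y : ℝ → ℝ`, continuous on `[R₀, ∞)`,
differentiable on `(R₀, ∞)` and satisfying `y ≤ c * y'` there with `0 < c`,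
(i) grows at least exponentially from its initial value, `y R₀ * exp ((R - R₀) / c) ≤ y R` for
`R ≥ R₀` (the growth dichotomy), and (ii) if moreover `y ≥ 0` on `[R₀, ∞)` and `y` has
sub-exponential growth (eventually `y R ≤ ε * exp ((R - R₀) / c)`, for every `ε > 0`), then
`y = 0` on `[R₀, ∞)` (the Liouville use-shape).

**Proof.** (i) The weighted profile `u R = y R * exp (-((R - R₀) / c))` is continuous on
`[R₀, ∞)`, differentiable on its interior `(R₀, ∞)` with
`u' R = (y' R - y R / c) * exp (-((R - R₀) / c)) ≥ 0`, hence monotone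
(`monotoneOn_of_deriv_nonneg`); `u R₀ ≤ u R` is the claim after multiplication by
`exp ((R - R₀) / c) > 0`. (ii) Fix `R' ≥ R₀` and apply (i) from the base point `R'`:
`y R' * exp ((R - R') / c) ≤ y R ≤ ε * exp ((R - R₀) / c)` for `R` large; with
`ε = y R' * exp (-((R' - R₀) / c)) / 2` this reads `y R' * E ≤ y R' * E / 2` with `E > 0`,
impossible if `y R' > 0`.

References: O. A. Ladyzhenskaya, V. A. Solonnikov, Zap. Nauchn. Sem. LOMI 96 (1980) 117–160
(Saint-Venant principle for Navier–Stokes in pipe-like domains); the calculus lemma is folklore.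
-/

set_option linter.dupNamespace false

noncomputable section

namespace Summit.AnomalousDissipation.AnomalousDissipation.Theorems

/-- Derivative of the integrating factor `R ↦ exp (-((R - R₀) / c))`. [folklore] -/
theorem saintVenant_hasDerivAt_weight (R₀ c R : ℝ) :
    HasDerivAt (fun R => Real.exp (-((R - R₀) / c)))
      (Real.exp (-((R - R₀) / c)) * (-(1 / c))) R := by
  have h : HasDerivAt (fun R => -((R - R₀) / c)) (-(1 / c)) R :=
    (((hasDerivAt_id R).sub_const R₀).div_const c).fun_neg
  exact h.exp

/-- The weighted profile `R ↦ y R * exp (-((R - R₀) / c))` is monotone on `[R₀, ∞)` when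
`y ≤ c * y'` on `(R₀, ∞)` and `0 < c`. [folklore] -/
theorem saintVenant_monotoneOn (y : ℝ → ℝ) (R₀ c : ℝ) (hc : 0 < c)
    (hcont : ContinuousOn y (Set.Ici R₀)) (hdiff : DifferentiableOn ℝ y (Set.Ioi R₀))
    (hineq : ∀ R, R₀ < R → y R ≤ c * deriv y R) :
    MonotoneOn (fun R => y R * Real.exp (-((R - R₀) / c))) (Set.Ici R₀) := by
  have hderiv : ∀ R, R₀ < R →
      HasDerivAt (fun R => y R * Real.exp (-((R - R₀) / c)))
        (deriv y R * Real.exp (-((R - R₀) / c))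
          + y R * (Real.exp (-((R - R₀) / c)) * (-(1 / c)))) R := by
    intro R hR
    have hy : HasDerivAt y (deriv y R) R :=
      ((hdiff R hR).differentiableAt (Ioi_mem_nhds hR)).hasDerivAt
    exact hy.mul (saintVenant_hasDerivAt_weight R₀ c R)
  have hw : Continuous fun R : ℝ => Real.exp (-((R - R₀) / c)) := by fun_prop
  refine monotoneOn_of_deriv_nonneg (convex_Ici R₀) (hcont.mul hw.continuousOn) ?_ ?_
  · rw [interior_Ici]
    intro R hR
    exact (hderiv R hR).differentiableAt.differentiableWithinAt
  · rw [interior_Ici]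
    intro R hR
    rw [(hderiv R hR).deriv]
    have hE : 0 < Real.exp (-((R - R₀) / c)) := Real.exp_pos _
    have h1 : y R / c ≤ deriv y R := by
      rw [div_le_iff₀ hc, mul_comm]
      exact hineq R hR
    have h2 : deriv y R * Real.exp (-((R - R₀) / c))
          + y R * (Real.exp (-((R - R₀) / c)) * (-(1 / c)))
        = (deriv y R - y R / c) * Real.exp (-((R - R₀) / c)) := by ring
    rw [h2]
    exact mul_nonneg (by linarith) hE.le

/-- **Saint-Venant growth dichotomy.** If `y` is continuous on `[R₀, ∞)`, differentiable on
`(R₀, ∞)` and `y ≤ c * y'` there with `0 < c`, then `y R₀ * exp ((R - R₀) / c) ≤ y R` for all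
`R ≥ R₀`. [folklore] -/
theorem saintVenant_dichotomy :
    ∀ (y : ℝ → ℝ) (R₀ c : ℝ), 0 < c → ContinuousOn y (Set.Ici R₀) →
      DifferentiableOn ℝ y (Set.Ioi R₀) → (∀ R, R₀ < R → y R ≤ c * deriv y R) →
      ∀ R, R₀ ≤ R → y R₀ * Real.exp ((R - R₀) / c) ≤ y R := by
  intro y R₀ c hc hcont hdiff hineq R hR
  have hmono := saintVenant_monotoneOn y R₀ c hc hcont hdiff hineq
  have h : y R₀ * Real.exp (-((R₀ - R₀) / c)) ≤ y R * Real.exp (-((R - R₀) / c)) :=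
    hmono Set.self_mem_Ici hR hR
  simp only [sub_self, zero_div, neg_zero, Real.exp_zero, mul_one] at h
  have hE : 0 < Real.exp ((R - R₀) / c) := Real.exp_pos _
  calc y R₀ * Real.exp ((R - R₀) / c)
      ≤ y R * Real.exp (-((R - R₀) / c)) * Real.exp ((R - R₀) / c) :=
        mul_le_mul_of_nonneg_right h hE.le
    _ = y R := by
        rw [mul_assoc, ← Real.exp_add, neg_add_cancel, Real.exp_zero, mul_one]

/-- **Liouville use-shape of the Saint-Venant dichotomy.** A profile `y ≥ 0` on `[R₀, ∞)`,
continuous there, differentiable on `(R₀, ∞)` with `y ≤ c * y'` (`0 < c`), and of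
sub-exponential growth (for every `ε > 0`, eventually `y R ≤ ε * exp ((R - R₀) / c)`) vanishes
on `[R₀, ∞)`. [folklore] -/
theorem saintVenant_liouville :
    ∀ (y : ℝ → ℝ) (R₀ c : ℝ), 0 < c → ContinuousOn y (Set.Ici R₀) →
      DifferentiableOn ℝ y (Set.Ioi R₀) → (∀ R, R₀ ≤ R → 0 ≤ y R) →
      (∀ R, R₀ < R → y R ≤ c * deriv y R) →
      (∀ ε, 0 < ε → ∃ R₁, ∀ R, R₁ ≤ R → y R ≤ ε * Real.exp ((R - R₀) / c)) →
      ∀ R, R₀ ≤ R → y R = 0 := by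
  intro y R₀ c hc hcont hdiff hnonneg hineq hgrowth R' hR'
  -- the dichotomy from the base point `R'`
  have hdich : ∀ R, R' ≤ R → y R' * Real.exp ((R - R') / c) ≤ y R :=
    saintVenant_dichotomy y R' c hc (hcont.mono fun x hx => le_trans hR' hx)
      (hdiff.mono fun x hx => lt_of_le_of_lt hR' hx)
      (fun R hR => hineq R (lt_of_le_of_lt hR' hR))
  refine le_antisymm (not_lt.mp fun hpos => ?_) (hnonneg R' hR')
  obtain ⟨R₁, hR₁⟩ :=
    hgrowth (y R' * Real.exp (-((R' - R₀) / c)) / 2)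
      (half_pos (mul_pos hpos (Real.exp_pos _)))
  have h1 := hdich (max R' R₁) (le_max_left _ _)
  have h2 := hR₁ (max R' R₁) (le_max_right _ _)
  have hE : Real.exp (-((R' - R₀) / c)) * Real.exp ((max R' R₁ - R₀) / c)
      = Real.exp ((max R' R₁ - R') / c) := by
    rw [← Real.exp_add]
    congr 1
    ring
  have h3 : y R' * Real.exp (-((R' - R₀) / c)) / 2 * Real.exp ((max R' R₁ - R₀) / c)
      = y R' * Real.exp ((max R' R₁ - R') / c) / 2 := by
    rw [← hE]
    ring
  have hprod : 0 < y R' * Real.exp ((max R' R₁ - R') / c) := mul_pos hpos (Real.exp_pos _)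
  linarith

/-- Registered stub `stub_saintVenant` (line `Sketch`, crux stmt-AnomalousDissipation-17917,
card saint-venant-cap-impedance): the Saint-Venant growth dichotomy (i) and its Liouville
use-shape (ii). [folklore] -/
theorem stub_saintVenant : (∀ (y : ℝ → ℝ) (R₀ c : ℝ), 0 < c → ContinuousOn y (Set.Ici R₀) → DifferentiableOn ℝ y (Set.Ioi R₀) → (∀ R, R₀ < R → y R ≤ c * deriv y R) → ∀ R, R₀ ≤ R → y R₀ * Real.exp ((R - R₀) / c) ≤ y R) ∧ (∀ (y : ℝ → ℝ) (R₀ c : ℝ), 0 < c → ContinuousOn y (Set.Ici R₀) → DifferentiableOn ℝ y (Set.Ioi R₀) → (∀ R, R₀ ≤ R → 0 ≤ y R) → (∀ R, R₀ < R → y R ≤ c * deriv y R) → (∀ ε, 0 < ε → ∃ R₁, ∀ R, R₁ ≤ R → y R ≤ ε * Real.exp ((R - R₀) / c)) → ∀ R, R₀ ≤ R → y R = 0) :=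
  ⟨saintVenant_dichotomy, saintVenant_liouville⟩

end Summit.AnomalousDissipation.AnomalousDissipation.Theorems
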